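import Summits.Ventures.HodgeRepro2.T6N43BergmanModel
import Summits.Ventures.HodgeRepro2.T6N43Explicit

/-!
# T6N43BergmanPlaces — THEOREM N4.3 on Bergman-explicit local data: the IR class of N4.3 is 0

Record: TIER5 §N4.3 (route/T5-N4-p5.md v13), THEOREM N4.3 (a)–(c) at the three real places; kernel form
`N43Places.N43_places` (T6N43Places.lean) with, per (1,1)-place, the interface binders (N4.3.P2)
`FockLineIdentification` (class AD on an abstract datum, 0 on `ExplicitU11` — T6N43Explicit.lean) and
(N4.3.P2′) `LowestWeightCoefficient` (class IR on an abstract datum — T6N43Ruhl / T6N43Bargmann reduce it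
to the Bargmann identification of π₀,τ′|SU(1,1) with Rühl's (3/2,+)). This file bundles the (1,1)-places
ON THE WEIGHT-3 BERGMAN MODEL (`ArchDoublingDatum.ofBergman`, T6N43BergmanModel.lean — on which BOTH Props
hold by construction) into `N43Places.BergmanU11`, the three places into `N43Places.BergmanPlaces`
(`p₁ : ExplicitU2` — the compact place on the polynomial Fock model as before — `p₂ p₃ : BergmanU11`), with
`BergmanPlaces.toPlaces : N43Places`, and proves THEOREM N4.3 on it with NO interface binder at all:
`N43_places_bergman` / `archNonvanishing_bergman` / `N43_places_bergman_withLfac` consume the displays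
`Hyp.EischenLiu2024_Sec2_2` (×3) and `Hyp.Ruhl1970_A2f` (×2) ONLY. The consumer theorems for the M2
carrier (the shape of T6N43ExplicitConsumer.lean): from `hx : D = X.toPlaces` alone, all FIVE interface
binders of `N43_places` (`binders_of_eq`), one by one (`characterCoefficient_of_eq`,
`fockLineIdentification₂_of_eq`, `fockLineIdentification₃_of_eq`, `lowestWeightCoefficient₂_of_eq`,
`lowestWeightCoefficient₃_of_eq`) and the NSide form `N43_places_withLfac_of_eq` — so a
`periodInputN_of_published`-type revision with `(XA XB : N43Places.BergmanPlaces)` and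
`hxA hxB` [EX] carries NO `hP2′` binder: the residual classes of N4.3 per side become AD 0, IR 0, EX 1,
AC 3 (D2), print 2 (D1). Declared EX content: the carrier's (1,1)-places ARE Bergman data (R3.7 + R3.11 as
a construction, T6N43BergmanModel.lean). No display, no new hypothesis. Axioms: {propext,
Classical.choice, Quot.sound}. §8(d): uses an L-value-free non-vanishing device: NO.
-/

namespace Summit.Ventures.HodgeRepro2.T6

open MeasureTheory

namespace N43Places

/-- The Bergman-explicit local data at a (1,1)-place (τ′₂ or τ′₃): the Haar measure, the matrix map into
`U(1,1)`, the forced-vector scalar `c ≠ 0` (`f = c · 1` on the lowest-weight line of the weight-3 Bergman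
model), the L-factor and the Eischen–Liu weight / twist parameters. DATA only (no field asserts a printed
theorem). -/
structure BergmanU11 where
  /-- the group carrier -/
  H : Type
  /-- its measurable structure -/
  [meas : MeasurableSpace H]
  /-- the Haar measure -/
  μ : Measure H
  /-- the matrices of `H` in the adapted basis -/
  rep : H → Matrix (Fin 2) (Fin 2) ℂ
  rep_mem : ∀ g, T5UnitaryBound.MemU11 (rep g)
  rep_measurable : ∀ i j, Measurable fun g => rep g i j
  /-- the forced-vector scalar: `f = c · 1` -/
  c : ℂ
  hc : c ≠ 0
  /-- the archimedean L-factor -/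
  Lfac : ℂ → ℂ
  /-- the Eischen–Liu weight `τ` (signature (1,1)) -/
  τ : Fin 1 → ℤ
  /-- the Eischen–Liu weight `ν` -/
  ν : Fin 1 → ℤ
  /-- the Eischen–Liu twist `r` -/
  r : ℤ

namespace BergmanU11

variable (X : BergmanU11)

/-- The measurable structure of the carrier, as an instance. -/
instance instMeasurableSpace : MeasurableSpace X.H := X.meas

/-- The Bergman doubling datum of the place (`ArchDoublingDatum.ofBergman`). -/
noncomputable def datum : ArchDoublingDatum X.H T5UnitaryBound.MemU11 :=
  ArchDoublingDatum.ofBergman X.μ X.rep X.rep_mem X.rep_measurable X.c X.hc X.Lfac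

/-- (N4.3.P2) on the Bergman datum, with no hypothesis. -/
theorem datum_fockLineIdentification : X.datum.FockLineIdentification :=
  ArchDoublingDatum.ofBergman_fockLineIdentification _ _ _ _ _ _ _

/-- (N4.3.P2′) on the Bergman datum, with no hypothesis. -/
theorem datum_lowestWeightCoefficient : X.datum.LowestWeightCoefficient :=
  ArchDoublingDatum.ofBergman_lowestWeightCoefficient _ _ _ _ _ _ _

/-- The Bergman datum's L-factor is the bundle's. -/
theorem datum_Lfac : X.datum.Lfac = X.Lfac := rfl

/-- The Bergman datum's measure is the bundle's. -/
theorem datum_μ : X.datum.μ = X.μ := rfl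

/-- The Bergman datum's matrix map is the bundle's. -/
theorem datum_rep : X.datum.rep = X.rep := rfl

end BergmanU11

/-- The three real places with Bergman-explicit (1,1)-places: the compact place on the polynomial Fock
model (`ExplicitU2`) and τ′₂, τ′₃ on the weight-3 Bergman model. -/
structure BergmanPlaces where
  /-- the compact place τ′₁ -/
  p₁ : ExplicitU2
  /-- the place τ′₂ -/
  p₂ : BergmanU11
  /-- the place τ′₃ -/
  p₃ : BergmanU11

namespace BergmanPlaces

variable (X : BergmanPlaces)

/-- The abstract bundle `N43Places` of a Bergman-explicit one (the M2 carrier's `d43` when its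
(1,1)-places are built on the Bergman model). -/
noncomputable def toPlaces : N43Places where
  H₁ := X.p₁.H
  meas₁ := X.p₁.meas
  d₁ := X.p₁.datum
  prob₁ := X.p₁.datum_prob
  m := X.p₁.m
  τ₁ := X.p₁.τ
  ν₁ := X.p₁.ν
  r₁ := X.p₁.r
  H₂ := X.p₂.H
  meas₂ := X.p₂.meas
  d₂ := X.p₂.datum
  τ₂ := X.p₂.τ
  ν₂ := X.p₂.ν
  r₂ := X.p₂.r
  H₃ := X.p₃.H
  meas₃ := X.p₃.meas
  d₃ := X.p₃.datum
  τ₃ := X.p₃.τ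
  ν₃ := X.p₃.ν
  r₃ := X.p₃.r

/-- The local data of the abstract bundle are the Bergman-explicit ones (`rfl` evaluation lemmas). -/
theorem toPlaces_d₁ : X.toPlaces.d₁ = X.p₁.datum := rfl
/-- τ′₂. -/
theorem toPlaces_d₂ : X.toPlaces.d₂ = X.p₂.datum := rfl
/-- τ′₃. -/
theorem toPlaces_d₃ : X.toPlaces.d₃ = X.p₃.datum := rfl

/-- THEOREM N4.3 (a)–(c) at all three places ON BERGMAN-EXPLICIT DATA: NO interface binder — the
(I-P2) and (I-P2′) binders of `N43_places` are discharged by construction; what remains is the displays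
`Hyp.EischenLiu2024_Sec2_2` (×3, on the bundle's own L-factors) and `Hyp.Ruhl1970_A2f` (×2). -/
theorem N43_places_bergman
    (hEL₁ : Hyp.EischenLiu2024_Sec2_2 2 0 X.p₁.τ X.p₁.ν X.p₁.r X.p₁.Lfac)
    (hA2f₂ : Hyp.Ruhl1970_A2f X.p₂.datum)
    (hEL₂ : Hyp.EischenLiu2024_Sec2_2 1 1 X.p₂.τ X.p₂.ν X.p₂.r X.p₂.Lfac)
    (hA2f₃ : Hyp.Ruhl1970_A2f X.p₃.datum)
    (hEL₃ : Hyp.EischenLiu2024_Sec2_2 1 1 X.p₃.τ X.p₃.ν X.p₃.r X.p₃.Lfac) :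
    (∀ j : Fin 3, 0 < (X.toPlaces.zetaAt j).re) ∧ X.toPlaces.ArchNonvanishing :=
  X.toPlaces.N43_places X.p₁.datum_characterCoefficient hEL₁ X.p₂.datum_fockLineIdentification
    X.p₂.datum_lowestWeightCoefficient hA2f₂ hEL₂ X.p₃.datum_fockLineIdentification
    X.p₃.datum_lowestWeightCoefficient hA2f₃ hEL₃

/-- The archimedean non-vanishing alone, on Bergman-explicit data. -/
theorem archNonvanishing_bergman
    (hEL₁ : Hyp.EischenLiu2024_Sec2_2 2 0 X.p₁.τ X.p₁.ν X.p₁.r X.p₁.Lfac)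
    (hA2f₂ : Hyp.Ruhl1970_A2f X.p₂.datum)
    (hEL₂ : Hyp.EischenLiu2024_Sec2_2 1 1 X.p₂.τ X.p₂.ν X.p₂.r X.p₂.Lfac)
    (hA2f₃ : Hyp.Ruhl1970_A2f X.p₃.datum)
    (hEL₃ : Hyp.EischenLiu2024_Sec2_2 1 1 X.p₃.τ X.p₃.ν X.p₃.r X.p₃.Lfac) :
    X.toPlaces.ArchNonvanishing :=
  (X.N43_places_bergman hEL₁ hA2f₂ hEL₂ hA2f₃ hEL₃).2

/-- THEOREM N4.3 on Bergman-explicit data with the L-factors RE-POINTED at a global datum's archimedean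
factors `L j` (the NSide form, T6N43Lfac / T6N43Contract): no interface binder. -/
theorem N43_places_bergman_withLfac (L : Fin 3 → ℂ → ℂ)
    (hEL₁ : Hyp.EischenLiu2024_Sec2_2 2 0 X.p₁.τ X.p₁.ν X.p₁.r (L 0))
    (hA2f₂ : Hyp.Ruhl1970_A2f X.p₂.datum)
    (hEL₂ : Hyp.EischenLiu2024_Sec2_2 1 1 X.p₂.τ X.p₂.ν X.p₂.r (L 1))
    (hA2f₃ : Hyp.Ruhl1970_A2f X.p₃.datum)
    (hEL₃ : Hyp.EischenLiu2024_Sec2_2 1 1 X.p₃.τ X.p₃.ν X.p₃.r (L 2)) :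
    (∀ j : Fin 3, 0 < ((X.toPlaces.withLfac L).zetaAt j).re) ∧
      (X.toPlaces.withLfac L).ArchNonvanishing :=
  X.toPlaces.N43_places_withLfac L X.p₁.datum_characterCoefficient hEL₁
    X.p₂.datum_fockLineIdentification X.p₂.datum_lowestWeightCoefficient hA2f₂ hEL₂
    X.p₃.datum_fockLineIdentification X.p₃.datum_lowestWeightCoefficient hA2f₃ hEL₃

/-! ### The consumer theorems for the M2 carrier (`hx : D = X.toPlaces`, class EX) -/

/-- ALL FIVE interface binders of `N43_places` for an abstract bundle `D` that IS the Bergman-explicit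
bundle `X`, from `hx : D = X.toPlaces` alone. -/
theorem binders_of_eq (D : N43Places) (hx : D = X.toPlaces) :
    D.d₁.CharacterCoefficient D.m ∧ D.d₂.FockLineIdentification ∧ D.d₂.LowestWeightCoefficient ∧
      D.d₃.FockLineIdentification ∧ D.d₃.LowestWeightCoefficient := by
  subst hx
  exact ⟨X.p₁.datum_characterCoefficient, X.p₂.datum_fockLineIdentification,
    X.p₂.datum_lowestWeightCoefficient, X.p₃.datum_fockLineIdentification,
    X.p₃.datum_lowestWeightCoefficient⟩

/-- (I-P2) at τ′₁ of an abstract bundle that is Bergman-explicit. -/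
theorem characterCoefficient_of_eq (D : N43Places) (hx : D = X.toPlaces) :
    D.d₁.CharacterCoefficient D.m :=
  (X.binders_of_eq D hx).1

/-- (I-P2) at τ′₂ of an abstract bundle that is Bergman-explicit. -/
theorem fockLineIdentification₂_of_eq (D : N43Places) (hx : D = X.toPlaces) :
    D.d₂.FockLineIdentification :=
  (X.binders_of_eq D hx).2.1

/-- (I-P2′) at τ′₂ of an abstract bundle that is Bergman-explicit. -/
theorem lowestWeightCoefficient₂_of_eq (D : N43Places) (hx : D = X.toPlaces) :
    D.d₂.LowestWeightCoefficient :=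
  (X.binders_of_eq D hx).2.2.1

/-- (I-P2) at τ′₃ of an abstract bundle that is Bergman-explicit. -/
theorem fockLineIdentification₃_of_eq (D : N43Places) (hx : D = X.toPlaces) :
    D.d₃.FockLineIdentification :=
  (X.binders_of_eq D hx).2.2.2.1

/-- (I-P2′) at τ′₃ of an abstract bundle that is Bergman-explicit. -/
theorem lowestWeightCoefficient₃_of_eq (D : N43Places) (hx : D = X.toPlaces) :
    D.d₃.LowestWeightCoefficient :=
  (X.binders_of_eq D hx).2.2.2.2

/-- THEOREM N4.3 for an abstract bundle that is Bergman-explicit, in the re-pointed (NSide) form: every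
interface binder replaced by `hx`; the displays remain. -/
theorem N43_places_withLfac_of_eq (D : N43Places) (hx : D = X.toPlaces) (L : Fin 3 → ℂ → ℂ)
    (hEL₁ : Hyp.EischenLiu2024_Sec2_2 2 0 D.τ₁ D.ν₁ D.r₁ (L 0))
    (hA2f₂ : Hyp.Ruhl1970_A2f D.d₂)
    (hEL₂ : Hyp.EischenLiu2024_Sec2_2 1 1 D.τ₂ D.ν₂ D.r₂ (L 1))
    (hA2f₃ : Hyp.Ruhl1970_A2f D.d₃)
    (hEL₃ : Hyp.EischenLiu2024_Sec2_2 1 1 D.τ₃ D.ν₃ D.r₃ (L 2)) :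
    (∀ j : Fin 3, 0 < ((D.withLfac L).zetaAt j).re) ∧ (D.withLfac L).ArchNonvanishing :=
  D.N43_places_withLfac L (X.characterCoefficient_of_eq D hx) hEL₁
    (X.fockLineIdentification₂_of_eq D hx) (X.lowestWeightCoefficient₂_of_eq D hx) hA2f₂ hEL₂
    (X.fockLineIdentification₃_of_eq D hx) (X.lowestWeightCoefficient₃_of_eq D hx) hA2f₃ hEL₃

end BergmanPlaces

end N43Places

end Summit.Ventures.HodgeRepro2.T6
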